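import Literature.MathematicalPhysics.QuantumFieldTheory.Balaban1983to89.B9Eq371GradLetters
import Literature.MathematicalPhysics.QuantumFieldTheory.Balaban1983to89.B9Eq375Composition

/-!
# `Balaban1983to89.B9Eq375GradLetters` — B9 p. 405 (3.75)/(3.73) with p. 407 «The operator V₃(A) is a local differential operator of
# the first order satisfying the bound (3.73)»: THE FIRST-ORDER PART `Σ_ν[seven-term bracket]_ν` OF THE VECTOR OPERATOR `V₂(A)` OF
# (3.75) IN GRADIENT FORM `V⁰ + Σ_k V¹_k∇_k` ON THE BOND CARRIER, letter by letter, with the (3.73)/(3.72) letter sizes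
# `|V⁰| ≦ O(1)α₁(Lʲη)⁻²`, `|V¹_k| ≦ O(1)α₁(Lʲη)⁻¹` as block majorants after real coordinates — second file of the G-side twin of
# `B9Eq352GradLetters`, companion of `B9Eq371GradLetters` (the `V₁` bracket of (3.71))

statement-level skeleton of published theorems with citation tags; proofs where landed; nothing here is a claim about the Yang–Mills mass gap

CITATION HEADER (lean-in-tree rule).  T. Bałaban, *Propagators for lattice gauge theories in a background field*, Commun.
Math. Phys. **99** (1985) 389–434 [Balaban1985BackgroundPropagators] (cell paper B9; held `paper:balaban1985-cmp99-background-
propagators`, journal page = PDF page + 388).  PDF held: p. 405 [PDF 17] (3.74)–(3.75) with (3.72)–(3.73), p. 407 [PDF 19]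
(3.82)–(3.85), read by this seat on the renders `b2b-balaban-ref1/pages/…-p017-x2.png`, `…-p019-x2.png` (2026-08-21); the
seven-term bracket of (3.75) is transcribed verbatim in `B9Eq375Composition` (pv27, docstring of `sBracket₂`), imported BY NAME.
THE PRINT (verbatim, p. 405; the frame sentences re-read on the render `…-p017-x2.png` by r06 gen 11 after ref-1 gen 41's note — v1
had spliced them): «Next we consider the operator DRD\*. We have discussed already the expansion (3.68) of the operator P(U′U), so we have
to consider the differential operators again. We have [(3.74)] (D_{U′U}D\*_{U′U}A′)_μ(x) = (D_U D\*_U A′)_μ(x) − Σ_{ν=1}^d [− iad_{A_μ(x)}R(U(x,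
x + ηe_μ))(D\*_νA′_ν)(x + ηe_μ) + R(U(x, x + ηe_μ))iad_{A_ν(x+ηe_μ)}(D\*_νA′_ν)(x + ηe_μ) − iad_{A_ν(x)}(D\*_νA′_ν)(x) + iad_{A_ν(x)}(D_μA′_ν)(x)
+ iad_{(D_μA_ν)(x)}R(U(x, x + ηe_μ))A′_ν(x + ηe_μ) + R(U(x, x + ηe_μ))iad_{(D\*_νA_ν)(x+ηe_μ)}·R(U(x + ηe_μ, x + ηe_μ − ηe_ν))A′_ν(x + ηe_μ −
ηe_ν) − iad_{(D\*_νA_ν)(x)}R(U(x, x − ηe_ν))A′_ν(x − ηe_ν)] − (F_{2,k}(A)A′)_μ(x) = (DD\*A′)_μ(x) − (V₂(A)A′)_μ(x), (3.75) where the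
operators F_{2,k}(A), V₂(A) satisfy the bounds (3.72), (3.73). These expansions imply the following one:» ((3.74), the expansion of
`D\*_{U′U}A′` printed between «We have» and (3.75), is not quoted here — it is `B9Eq375Composition`'s (3.74)); (3.73) p. 405: «|(V₁(A)A′)(b)| ≦ O(1)(|A||∇A′| + |∇A||A′| +
|A|²|A′|) ≦ O(1)α₁((Lʲη)⁻¹|∇A′| + (Lʲη)⁻²|A′|), b ∈ Ω_j»; p. 407: «The operator V₃(A) is a local differential operator of the first
order satisfying the bound (3.73).»; (3.37) p. 396: «|A′| < α₁(Lʲη)⁻¹, |∇^η_UA′| < α₁(Lʲη)⁻² on Ω_j».  [4] = T. Bałaban, *Propagators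
and renormalization transformations for lattice gauge theories. II*, Commun. Math. Phys. **96** (1984) 223–250
[Balaban1984PropagatorsII], (2.51)–(2.52) p. 232.  Cell `lit-balaban`, seat r06 (B9 fold owner) gen 10; SKELETON rows **B9.Eq3.74**
((3.74)–(3.75)) × **B9.Eq3.85** × B9.Thm3.4 (the `hV0`/`hV1` letter hypotheses of this seat's G-side devices `B9Ineq385VG.ineq385_op`,
`B9Ineq386CommSum.ineq385_op_sum` / `thm34_G_entries13_opForm_of_comm_sum`, for the `V₂`-part of `V₃ = V₁ − (Δ′(U′U) − Δ′(U)) + V₂`).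

WHY THIS FILE, AND WHY «GRADIENT FORM» IS A READING.  As in `B9Eq371GradLetters` (see its header): the G-side devices take
`V₃ = V⁰ + Σ_k V¹_k·∇_k` with block majorants of the (3.73) sizes as HYPOTHESES — this seat's operator reading of «local
differential operator of the first order satisfying (3.73)»; the print displays no such decomposition.  THIS FILE rewrites the
seven-term bracket of (3.75), as pv27 typed it (`B9Eq375Composition.sBracket₂`, ×η²), EXACTLY as `V⁰ + Σ_{k∈κ⊕κ} V¹_k∇_k` on the
bond carrier `κ × S` of `B9Eq371GradLetters` (`bT`, `bU`; gen 8's difference letters `diffLetter`), with EXPLICIT local letters —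
here with the FORWARD transports `τ_μ` of (3.70) (`B9Eq352DivForm.tauF`) and one double transport `τ_μτ*_ν` (term 6) — and gives
each letter its (3.73)-size block majorant from (3.37) read blockwise on the stencil of the output bond, by gen 8's seam lemma
`B9Eq352DivFormLetters.hasMajorant_conj_of_local`.

WHAT THIS FILE PROVES (0 sorry; defs with bodies + theorems; no `def … : Prop`).
* §1 the letters (all `Module.End ℝ (κ × S → 𝔸)`): `zeroLetter₂ c A` (terms 5, 6, 7: `iad_{c·(D¹_μA_ν)(x)}∘τ_μ`, `iad_{c·τ_μ(D¹*_νA_ν)(x)}∘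
  τ_μτ*_ν`, `−iad_{c·(D¹*_νA_ν)(x)}∘τ*_ν`, reading the component ν into the component μ), `mixLetterF₂ A k₀` (term 4: `iad_{A_ν(x)}`,
  output component `k₀` = the direction of the forward difference, input components ν), `mixLetterB₂ A k₀` (terms 1, 2, 3: the
  coefficients of the backward difference `∇_{inr k₀}` of the component `k₀`, with the transports `τ_μ`), `V1Letter₂` (`inl k₀ ↦
  mixLetterF₂`, `inr k₀ ↦ mixLetterB₂` — NO diagonal coefficient letter on this side), `V₂brkOp c A := zeroLetter₂ + Σ_k V1Letter₂ k ∘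
  diffLetter c k` — the first-order part of `V₂(A)` DEFINED in gradient form.
* §2 `brk₂` (the bracket in true units, ordered as printed), `sBracket₂_eq_brk₂` (pv27's `sBracket₂_ν = η²·brk₂_ν`, term by term, by
  `R(V)[b,Z] = [R(V)b, R(V)Z]` and scalar bookkeeping), `V₂brkOp_apply` (the letters read the bracket), **`sum_sBracket₂_eq`** — THE
  IDENTITY: for `η ≠ 0`, `Σ_ν sBracket₂ T U η A A′ ν μ x = η²·(V₂brkOp η⁻¹ A)(A′)(μ, x)`; with pv27's `gradDiv_prodCfg_eq_sBracket₂`: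
  `D¹D¹*_{U′U}A′ = D¹D¹*_UA′ − η²·V₂brkOp(A′) − F₂op` (`gradDiv_prodCfg_eq_gradForm`).
* §3 THE (3.73) LETTER SIZES as block majorants after real coordinates (`conj b`, carrier `(κ × S) × ι`, block map `((μ,x),i) ↦ y(x)`),
  every O(1) explicit: `hasMajorant_mixLetterF₂` (`≺ 2d·M₂(Σ‖b_i‖)e^{δd₀}·α₁(Lʲη)⁻¹e^{−δd}`), `hasMajorant_mixLetterB₂` (`≺ 2(1+2ρ²)·M₂(Σ‖b_i‖)
  e^{δd₀}·α₁(Lʲη)⁻¹e^{−δd}`), **`hasMajorant_V1Letter₂`** (the `hV1` shape for every `k ∈ κ ⊕ κ`, one constant `2(1+2ρ²)(d+1)M₂(Σ‖b_i‖)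
  e^{δd₀}`), **`hasMajorant_zeroLetter₂`** (the `hV0` shape for this part, `≺ 2(2ρ²+ρ⁶)d·M₂(Σ‖b_i‖)e^{δd₀}·α₁(Lʲη)⁻²e^{−δd}`), and the
  conjugated gradient form `conj_V₂brkOp_eq_gradForm`.

HONEST SCOPE / NOT CLAIMED.  (i) ONLY the first-order bracket of `V₂(A)`; the higher-order part `F_{2,k}(A)` ((3.72), pv27's `F₂op`)
— like `F_{1,k}`, `Δ′(U′U) − Δ′(U)` and the commutator letters — is NOT treated here (successor files), so no hypothesis of the
G-side devices is discharged for the full `V₃` yet.  (ii) (3.37) enters BLOCKWISE ON THE STENCIL OF THE OUTPUT BOND, measured at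
the scale of the output's block (the print's convention «the same norms |A|, |A′| determined by the set st(b)», «b ∈ Ω_j»):
`‖A_k(x)‖`, `‖(τ_μA_k)(x)‖ ≦ α₁(Lʲη)⁻¹`; `‖c·(D¹_μA_ν)(x)‖`, `‖c·(D¹*_νA_ν)(x)‖`, `‖c·(D¹*_νA_ν)(x+e_μ)‖ ≦ α₁(Lʲη)⁻²` (`c = η⁻¹`) for all
μ, ν, k and `x ∈ Δ(y)`, `y ∈ Λ_j`; transports `‖U‖, ‖U⁻¹‖ ≦ ρ`; stencil geometry `d(y(x), y(x+e_μ))`, `d(y(x), y(x−e_ν))`,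
`d(y(x), y(x+e_μ−e_ν))`, `d(y,y) ≦ d₀`; `𝔸` finite-dimensional over ℝ with basis `b`, `|b.repr v i| ≦ M₂‖v‖`.  (iii) «Gradient form»
is this seat's reading (see WHY).  (iv) Abstract carrier: arbitrary sites `S`, directions `κ`, shifts `T`, units `U` (no
commutation of shifts, no unitarity).  Value = the `V₂`-bracket third of the `hV0`/`hV1` inputs of the G-side Theorem-3.4 devices
made theorems about concrete lattice operators; NOT summit progress.

RELATED IN THE TREE, NOT DUPLICATED (searched 2026-08-21: `lean search --decl 'mixLetterF₂|zeroLetter₂|V₂brkOp'` = ∅;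
`B9Eq375Composition`/`B9Eq375Locality`/`B9Eq372Operator` (pv27) give `V₂(A)A′` pointwise, its (non-)locality and its operator
norm — USED (the bracket) / complementary (norms); `B9Eq371GradLetters` (this seat, gen 10) is the `V₁` companion whose bond carrier
`bT`/`bU` and conventions are RE-USED, not re-declared).
-/

noncomputable section

namespace Literature.MathematicalPhysics.QuantumFieldTheory.Balaban1983to89.B9Eq375GradLetters

open NormedSpace Complex
open Literature.MathematicalPhysics.QuantumFieldTheory.Balaban1983to89
open Literature.MathematicalPhysics.QuantumFieldTheory.Balaban1983to89.B6RandomWalk (HasMajorant hasMajorant_mono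
  hasMajorant_add)
open Literature.MathematicalPhysics.QuantumFieldTheory.Balaban1983to89.B9Thm34Ext (toB6)
open Literature.MathematicalPhysics.QuantumFieldTheory.Balaban1983to89.Beta.BackgroundVertices (ad norm_ad_le ad_smul_right
  ad_smul_left ad_add_right ad_sub_right ad_add_left ad_sub_left ad_apply)
open Literature.MathematicalPhysics.QuantumFieldTheory.Balaban1983to89.B9Eq39Adjoint
open Literature.MathematicalPhysics.QuantumFieldTheory.Balaban1983to89.B9Eq370Expansion (norm_R_le)
open Literature.MathematicalPhysics.QuantumFieldTheory.Balaban1983to89.B9Eq371Composition (R_ad norm_R_le_sq)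
open Literature.MathematicalPhysics.QuantumFieldTheory.Balaban1983to89.B9Eq375Composition (sBracket₂ gradDiv F₂op
  gradDiv_prodCfg_eq_sBracket₂)
open Literature.MathematicalPhysics.QuantumFieldTheory.Balaban1983to89.B9Eq352DivForm (tauF tauB tauF_apply tauB_apply)
open Literature.MathematicalPhysics.QuantumFieldTheory.Balaban1983to89.B9Eq352DivFormLetters
open Literature.MathematicalPhysics.QuantumFieldTheory.Balaban1983to89.B9Eq352GradLetters (diffLetter diffLetter_inl
  diffLetter_inr conj_add conj_finset_sum)
open Literature.MathematicalPhysics.QuantumFieldTheory.Balaban1983to89.B9Eq371GradLetters (bT bU bT_apply bT_symm_apply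
  bU_apply covD_bond covDstar_bond)

/-! ## §1  The letters of the seven-term bracket of (3.75) on the bond carrier -/

section Letters0

variable {𝔸 : Type*} [NormedRing 𝔸] [NormedAlgebra ℂ 𝔸] {S : Type} {κ : Type}
variable (T : κ → Equiv.Perm S) (U : κ → S → 𝔸ˣ)

omit [NormedAlgebra ℂ 𝔸] in
/-- `R(V)(r·X) = r·R(V)X` for REAL scalars. [folklore] -/
private theorem R_real_smul [NormedAlgebra ℂ 𝔸] (V : 𝔸ˣ) (r : ℝ) (X : 𝔸) : R V (r • X) = r • R V X := by
  rw [R_def, R_def, mul_smul_comm, smul_mul_assoc]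

/-- **The coefficient letter of the backward difference `∇_{inr k₀}` of the component `k₀` (terms 1, 2, 3)**: `G ↦ ((μ,x) ↦
i[A_μ(x), (τ_μG_{k₀})(x)] − i[(τ_μA_{k₀})(x), (τ_μG_{k₀})(x)] + i[A_{k₀}(x), G_{k₀}(x)])` — the coefficients of `(D*_νA′_ν)` in
«− iad_{A_μ(x)}R(U(x, x + ηe_μ))(D*_νA′_ν)(x + ηe_μ) + R(U(x, x + ηe_μ))iad_{A_ν(x+ηe_μ)}(D*_νA′_ν)(x + ηe_μ) − iad_{A_ν(x)}(D*_νA′_ν)(x)» read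
against gen 8's backward letter `∇_{inr ν} = −η⁻¹D¹*_ν` (the sign flips), `R(V)[b,Z] = [R(V)b, R(V)Z]` on term 2.
[cite: Balaban1985BackgroundPropagators, (3.75) p.405 + (3.73) p.405] -/
def mixLetterB₂ (A : κ → S → 𝔸) (k₀ : κ) : Module.End ℝ (κ × S → 𝔸) where
  toFun G := fun p => (I : ℂ) • ad (A p.1 p.2) (tauF T U p.1 (fun z => G (k₀, z)) p.2)
    - (I : ℂ) • ad (tauF T U p.1 (A k₀) p.2) (tauF T U p.1 (fun z => G (k₀, z)) p.2)
    + (I : ℂ) • ad (A k₀ p.2) (G (k₀, p.2))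
  map_add' G G' := by
    funext p
    simp only [Pi.add_apply, tauF_apply, R_add, ad_add_right, smul_add]
    abel
  map_smul' r G := by
    funext p
    simp only [Pi.smul_apply, RingHom.id_apply, tauF_apply, R_real_smul, ad_smul_right, smul_add, smul_sub]
    rw [smul_comm r (I : ℂ), smul_comm r (I : ℂ), smul_comm r (I : ℂ)]

/-- Unfolding `mixLetterB₂`. [cite: Balaban1985BackgroundPropagators, (3.75) p.405] -/
theorem mixLetterB₂_apply (A : κ → S → 𝔸) (k₀ : κ) (G : κ × S → 𝔸) (p : κ × S) :
    mixLetterB₂ T U A k₀ G p = (I : ℂ) • ad (A p.1 p.2) (tauF T U p.1 (fun z => G (k₀, z)) p.2)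
      - (I : ℂ) • ad (tauF T U p.1 (A k₀) p.2) (tauF T U p.1 (fun z => G (k₀, z)) p.2)
      + (I : ℂ) • ad (A k₀ p.2) (G (k₀, p.2)) := rfl

variable [Fintype κ]

/-- **`V⁰` of the bracket of (3.75) (terms 5, 6, 7)**: `F ↦ ((μ,x) ↦ Σ_ν ( i[c·(D¹_μA_ν)(x), (τ_μF_ν)(x)] + i[c·τ_μ(D¹*_νA_ν)(x),
(τ_μτ*_νF_ν)(x)] − i[c·(D¹*_νA_ν)(x), (τ*_νF_ν)(x)] ))`, `c = η⁻¹` — the zeroth-order letters «iad_{(D_μA_ν)(x)}R(U(x, x + ηe_μ))A′_ν(x +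
ηe_μ)», «R(U(x, x + ηe_μ))iad_{(D*_νA_ν)(x+ηe_μ)}·R(U(x + ηe_μ, x + ηe_μ − ηe_ν))A′_ν(x + ηe_μ − ηe_ν)», «− iad_{(D*_νA_ν)(x)}R(U(x, x −
ηe_ν))A′_ν(x − ηe_ν)». [cite: Balaban1985BackgroundPropagators, (3.75) p.405 + (3.73) p.405] -/
def zeroLetter₂ (c : ℂ) (A : κ → S → 𝔸) : Module.End ℝ (κ × S → 𝔸) where
  toFun F := fun p => ∑ ν, ((I : ℂ) • ad (c • covD T U p.1 (A ν) p.2) (tauF T U p.1 (fun z => F (ν, z)) p.2)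
    + (I : ℂ) • ad (c • tauF T U p.1 (covDstar T U ν (A ν)) p.2)
        (tauF T U p.1 (tauB T U ν (fun w => F (ν, w))) p.2)
    - (I : ℂ) • ad (c • covDstar T U ν (A ν) p.2) (tauB T U ν (fun w => F (ν, w)) p.2))
  map_add' F F' := by
    funext p
    dsimp only [Pi.add_apply]
    rw [← Finset.sum_add_distrib]
    refine Finset.sum_congr rfl fun ν _ => ?_
    simp only [tauF_apply, tauB_apply, R_add, ad_add_right, smul_add]
    abel
  map_smul' r F := by
    funext p
    dsimp only [Pi.smul_apply, RingHom.id_apply]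
    rw [Finset.smul_sum]
    refine Finset.sum_congr rfl fun ν _ => ?_
    simp only [tauF_apply, tauB_apply, R_real_smul, ad_smul_right, smul_add, smul_sub]
    rw [smul_comm r (I : ℂ), smul_comm r (I : ℂ), smul_comm r (I : ℂ)]

/-- Unfolding `zeroLetter₂`. [cite: Balaban1985BackgroundPropagators, (3.75) p.405] -/
theorem zeroLetter₂_apply (c : ℂ) (A : κ → S → 𝔸) (F : κ × S → 𝔸) (p : κ × S) :
    zeroLetter₂ T U c A F p = ∑ ν, ((I : ℂ) • ad (c • covD T U p.1 (A ν) p.2) (tauF T U p.1 (fun z => F (ν, z)) p.2)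
      + (I : ℂ) • ad (c • tauF T U p.1 (covDstar T U ν (A ν)) p.2)
          (tauF T U p.1 (tauB T U ν (fun w => F (ν, w))) p.2)
      - (I : ℂ) • ad (c • covDstar T U ν (A ν) p.2) (tauB T U ν (fun w => F (ν, w)) p.2)) := rfl

variable [DecidableEq κ]

omit T U in
/-- **The coefficient letter of the forward difference `∇_{k₀}` (term 4)**: `G ↦ ((μ,x) ↦ 𝟙[μ = k₀]·Σ_ν i[A_ν(x), G_ν(x)])` — the
coefficient of `(D_μA′_ν)(x)` in «iad_{A_ν(x)}(D_μA′_ν)(x)», the derivative direction being the OUTPUT component μ = k₀ and the input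
component ν. [cite: Balaban1985BackgroundPropagators, (3.75) p.405 + (3.73) p.405] -/
def mixLetterF₂ (A : κ → S → 𝔸) (k₀ : κ) : Module.End ℝ (κ × S → 𝔸) where
  toFun G := fun p => (if p.1 = k₀ then (1 : ℝ) else 0) • ∑ ν, (I : ℂ) • ad (A ν p.2) (G (ν, p.2))
  map_add' G G' := by
    funext p
    dsimp only [Pi.add_apply]
    rw [← smul_add (if p.1 = k₀ then (1 : ℝ) else 0), ← Finset.sum_add_distrib]
    congr 1
    refine Finset.sum_congr rfl fun ν _ => ?_
    rw [ad_add_right, smul_add]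
  map_smul' r G := by
    funext p
    dsimp only [Pi.smul_apply, RingHom.id_apply]
    rw [smul_comm r (if p.1 = k₀ then (1 : ℝ) else 0)]
    congr 1
    rw [Finset.smul_sum]
    refine Finset.sum_congr rfl fun ν _ => ?_
    rw [ad_smul_right, smul_comm r (I : ℂ)]

omit T U in
/-- Unfolding `mixLetterF₂`. [cite: Balaban1985BackgroundPropagators, (3.75) p.405] -/
theorem mixLetterF₂_apply (A : κ → S → 𝔸) (k₀ : κ) (G : κ × S → 𝔸) (p : κ × S) :
    mixLetterF₂ A k₀ G p = (if p.1 = k₀ then (1 : ℝ) else 0) • ∑ ν, (I : ℂ) • ad (A ν p.2) (G (ν, p.2)) := rfl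

/-- **The coefficient letters `V¹_k` of the bracket of (3.75)**, `k ∈ κ ⊕ κ`: `inl k₀ ↦ mixLetterF₂ k₀` (term 4), `inr k₀ ↦
mixLetterB₂ k₀` (terms 1, 2, 3). [cite: Balaban1985BackgroundPropagators, (3.75) p.405 + (3.73) p.405] -/
def V1Letter₂ (A : κ → S → 𝔸) : κ ⊕ κ → Module.End ℝ (κ × S → 𝔸)
  | Sum.inl k₀ => mixLetterF₂ A k₀
  | Sum.inr k₀ => mixLetterB₂ T U A k₀

/-- **THE FIRST-ORDER PART OF `V₂(A)` DEFINED IN GRADIENT FORM**: `V₂brkOp c A := V⁰ + Σ_{k∈κ⊕κ} V¹_k ∘ ∇_k` with gen 8's difference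
letters on the bond carrier (`c = η⁻¹`); §2 proves that `η²·V₂brkOp η⁻¹ A` IS pv27's `Σ_ν sBracket₂_ν`.
[cite: Balaban1985BackgroundPropagators, (3.75) p.405 + (3.73) p.405] -/
def V₂brkOp (c : ℂ) (A : κ → S → 𝔸) : Module.End ℝ (κ × S → 𝔸) :=
  zeroLetter₂ T U c A + ∑ k, V1Letter₂ T U A k * diffLetter (bT T) (bU U) c k

/-- `V1Letter₂` on a forward index. [cite: Balaban1985BackgroundPropagators, (3.75) p.405] -/
theorem V1Letter₂_inl (A : κ → S → 𝔸) (k₀ : κ) : V1Letter₂ T U A (Sum.inl k₀) = mixLetterF₂ A k₀ := rfl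

/-- `V1Letter₂` on a backward index. [cite: Balaban1985BackgroundPropagators, (3.75) p.405] -/
theorem V1Letter₂_inr (A : κ → S → 𝔸) (k₀ : κ) : V1Letter₂ T U A (Sum.inr k₀) = mixLetterB₂ T U A k₀ := rfl

/-- `V₂brkOp` unfolds to the gradient form over `univ` (the `hV₃`-shape of the finite-sum device for this part, before coordinates).
[cite: Balaban1985BackgroundPropagators, (3.75) p.405 + (3.73) p.405] -/
theorem V₂brkOp_eq_gradForm (c : ℂ) (A : κ → S → 𝔸) :
    V₂brkOp T U c A = zeroLetter₂ T U c A + ∑ k ∈ Finset.univ, V1Letter₂ T U A k * diffLetter (bT T) (bU U) c k := rfl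

end Letters0

/-! ## §2  The identity: pv27's seven-term bracket of (3.75), summed over ν, IS `η²·(V⁰ + Σ_k V¹_k∇_k)` -/

section Bracket

variable {𝔸 : Type*} [NormedRing 𝔸] [NormedAlgebra ℂ 𝔸] {S : Type} {κ : Type}
variable (T : κ → Equiv.Perm S) (U : κ → S → 𝔸ˣ)

/-- The seven-term bracket of (3.75) in TRUE UNITS, in the printed order (`c = η⁻¹`), as the letters read it.
[cite: Balaban1985BackgroundPropagators, (3.75) p.405] -/
def brk₂ (c : ℂ) (A : κ → S → 𝔸) (F : κ × S → 𝔸) (ν μ : κ) (x : S) : 𝔸 :=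
  (I : ℂ) • ad (A μ x) (tauF T U μ (fun z => -(c • covDstar T U ν (fun w => F (ν, w)) z)) x)
  + -((I : ℂ) • ad (tauF T U μ (A ν) x) (tauF T U μ (fun z => -(c • covDstar T U ν (fun w => F (ν, w)) z)) x))
  + (I : ℂ) • ad (A ν x) (-(c • covDstar T U ν (fun w => F (ν, w)) x))
  + (I : ℂ) • ad (A ν x) (c • covD T U μ (fun w => F (ν, w)) x)
  + (I : ℂ) • ad (c • covD T U μ (A ν) x) (tauF T U μ (fun z => F (ν, z)) x)
  + (I : ℂ) • ad (c • tauF T U μ (covDstar T U ν (A ν)) x) (tauF T U μ (tauB T U ν (fun w => F (ν, w))) x)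
  + -((I : ℂ) • ad (c • covDstar T U ν (A ν) x) (tauB T U ν (fun w => F (ν, w)) x))

omit [NormedAlgebra ℂ 𝔸] in
/-- `[a, −m] = −[a, m]`. [folklore] -/
private theorem ad_neg_right' (a m : 𝔸) : ad a (-m) = -ad a m := by
  simp only [ad_apply, mul_neg, neg_mul, neg_sub]
  abel

/-- **pv27's seven-term bracket of (3.75) IS `η²·brk₂`** (per direction ν; `η ≠ 0`), with `A′_ν(z) = F(ν, z)` — terms 2 and 6 by
`R(V)[b, Z] = [R(V)b, R(V)Z]`, the rest scalar bookkeeping `iη·[a, Z] = η²·i·[a, η⁻¹Z]`.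
[cite: Balaban1985BackgroundPropagators, (3.75) p.405] -/
theorem sBracket₂_eq_brk₂ {η : ℝ} (hη : η ≠ 0) (A : κ → S → 𝔸) (F : κ × S → 𝔸) (ν μ : κ) (x : S) :
    sBracket₂ T U η A (fun k z => F (k, z)) ν μ x = ((η : ℂ) ^ 2) • brk₂ T U ((η : ℂ)⁻¹) A F ν μ x := by
  have hη' : (η : ℂ) ≠ 0 := Complex.ofReal_ne_zero.mpr hη
  have hs : (η : ℂ) ^ 2 * I * (η : ℂ)⁻¹ = I * η := by
    field_simp
  simp only [sBracket₂, brk₂, covD, covDstar, tauF_apply, tauB_apply, R_ad, R_sub, R_neg, R_smul, ad_smul_left,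
    ad_smul_right, ad_sub_left, ad_sub_right, ad_neg_right', smul_add, smul_sub, smul_neg, smul_smul, ← mul_assoc, hs]
  abel

end Bracket

section Identity

variable {𝔸 : Type*} [NormedRing 𝔸] [NormedAlgebra ℂ 𝔸] {S : Type} {κ : Type} [Fintype κ] [DecidableEq κ]
variable (T : κ → Equiv.Perm S) (U : κ → S → 𝔸ˣ)

/-- **The letters read the bracket**: `(V₂brkOp c A)(F)(μ, x) = Σ_ν brk₂_ν` (unfolding the gradient form: `mixLetterF₂` gives term 4
after `Σ_{k₀} 𝟙[μ = k₀]`, `mixLetterB₂` terms 1, 2, 3, `zeroLetter₂` terms 5, 6, 7).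
[cite: Balaban1985BackgroundPropagators, (3.75) p.405 + (3.73) p.405] -/
theorem V₂brkOp_apply (c : ℂ) (A : κ → S → 𝔸) (F : κ × S → 𝔸) (p : κ × S) :
    V₂brkOp T U c A F p = ∑ ν, brk₂ T U c A F ν p.1 p.2 := by
  obtain ⟨μ, x⟩ := p
  simp only [V₂brkOp, V1Letter₂_inl, V1Letter₂_inr, diffLetter_inl, diffLetter_inr, LinearMap.add_apply,
    LinearMap.sum_apply, Module.End.mul_apply, LinearMap.neg_apply, Fintype.sum_sum_type, Pi.add_apply, Finset.sum_apply,
    Pi.neg_apply, gradLetterF_apply, gradLetterB_apply, zeroLetter₂_apply, mixLetterF₂_apply, mixLetterB₂_apply, covD_bond,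
    covDstar_bond]
  -- the indicator sum `Σ_{k₀} 𝟙[μ = k₀]·X k₀ = X μ`
  simp only [Finset.sum_add_distrib, ite_smul, one_smul, zero_smul, Finset.sum_ite_eq, Finset.mem_univ, if_true]
  simp only [brk₂, Finset.sum_add_distrib, Finset.sum_neg_distrib, Finset.sum_sub_distrib, tauF_apply, tauB_apply, R_smul,
    R_neg, ad_smul_right, ad_neg_right', smul_neg]
  abel

/-- **THE IDENTITY (3.75) ⇆ gradient form**: for `η ≠ 0`, `Σ_ν sBracket₂ T U η A A′ ν μ x = η²·(V₂brkOp η⁻¹ A)(A′)(μ, x)` with `A′`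
read on the bond carrier. [cite: Balaban1985BackgroundPropagators, (3.75) p.405 + (3.73) p.405] -/
theorem sum_sBracket₂_eq {η : ℝ} (hη : η ≠ 0) (A : κ → S → 𝔸) (F : κ × S → 𝔸) (μ : κ) (x : S) :
    ∑ ν, sBracket₂ T U η A (fun k z => F (k, z)) ν μ x = ((η : ℂ) ^ 2) • V₂brkOp T U ((η : ℂ)⁻¹) A F (μ, x) := by
  rw [V₂brkOp_apply, Finset.smul_sum]
  exact Finset.sum_congr rfl fun ν _ => sBracket₂_eq_brk₂ T U hη A F ν μ x

/-- **(3.75) with the gradient form in place**: `(D¹_{U′U}D¹*_{U′U}A′)_μ(x) = (D¹_UD¹*_UA′)_μ(x) − η²·(V₂brkOp η⁻¹ A)(A′)(μ,x) −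
(F_{2,k}(A)A′)_μ(x)` (pv27's `gradDiv_prodCfg_eq_sBracket₂` rewritten). [cite: Balaban1985BackgroundPropagators, (3.75) p.405] -/
theorem gradDiv_prodCfg_eq_gradForm [CompleteSpace 𝔸] {η : ℝ} (hη : η ≠ 0) (A : κ → S → 𝔸) (F : κ × S → 𝔸) (μ : κ)
    (x : S) :
    gradDiv T (prodCfg U η A) (fun k z => F (k, z)) μ x
      = gradDiv T U (fun k z => F (k, z)) μ x - ((η : ℂ) ^ 2) • V₂brkOp T U ((η : ℂ)⁻¹) A F (μ, x)
        - F₂op T U η A (fun k z => F (k, z)) μ x := by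
  rw [gradDiv_prodCfg_eq_sBracket₂, sum_sBracket₂_eq T U hη]

end Identity

/-! ## §3  The (3.73) letter sizes as block majorants after real coordinates -/

section Majorants0

variable {𝔸 : Type*} [NormedRing 𝔸] [NormedAlgebra ℂ 𝔸] {ι : Type} [Fintype ι]
variable (b : Module.Basis ι ℝ 𝔸) {S : Type} {κ : Type}
variable (T : κ → Equiv.Perm S) (U : κ → S → 𝔸ˣ)
variable {g : B9.Geometry} [Fintype g.Site] {Rr : ℝ} {H : Prop}

omit [Fintype ι] b T U [Fintype g.Site] in
/-- `‖i·[a, Z]‖ ≦ 2st` when `‖a‖ ≦ s`, `‖Z‖ ≦ t`. [folklore] -/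
private theorem norm_I_ad_le {a Z : 𝔸} {s t : ℝ} (ha : ‖a‖ ≤ s) (hZ : ‖Z‖ ≤ t) : ‖(I : ℂ) • ad a Z‖ ≤ 2 * s * t := by
  rw [norm_smul, Complex.norm_I, one_mul]
  have hs : 0 ≤ s := (norm_nonneg _).trans ha
  exact (norm_ad_le _ _).trans (mul_le_mul (mul_le_mul_of_nonneg_left ha zero_le_two) hZ (norm_nonneg _) (by positivity))

/-- **`hV1` FOR THE BACKWARD COEFFICIENT LETTER** (terms 1, 2, 3): under (3.37) read blockwise on the stencil of the output bond
(`‖A_k(x)‖`, `‖(τ_μA_k)(x)‖ ≦ α₁(Lʲη)⁻¹` for all μ, k, `x ∈ Δ(y)`), transports `‖U‖, ‖U⁻¹‖ ≦ ρ`, stencil geometry `d(y(x), y(x+e_μ)) ≦ d₀`,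
`d(y,y) ≦ d₀`: `conj b (mixLetterB₂ A k₀) ≺ 2(1+2ρ²)·M₂(Σ‖b_i‖)e^{δd₀}·α₁(Lʲη)⁻¹·e^{−δd}`.
[cite: Balaban1985BackgroundPropagators, (3.37) p.396 + (3.75) p.405 + (3.73) p.405; Balaban1984PropagatorsII, (2.51) p.232] -/
theorem hasMajorant_mixLetterB₂ (blk : S → g.Site) (A : κ → S → 𝔸) (ρ d₀ δ M₂ α₁ : ℝ)
    (hα₁ : 0 ≤ α₁) (hδ : 0 ≤ δ) (hM₂ : 0 ≤ M₂) (hrepr : ∀ (v : 𝔸) (i : ι), |b.repr v i| ≤ M₂ * ‖v‖)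
    (hlen : ∀ y : g.Site, 0 < g.len y)
    (hA : ∀ k x, ‖A k x‖ ≤ α₁ * (g.len (blk x))⁻¹) (hAτ : ∀ μ k x, ‖tauF T U μ (A k) x‖ ≤ α₁ * (g.len (blk x))⁻¹)
    (hρ : ∀ μ x, ‖((U μ x : 𝔸ˣ) : 𝔸)‖ ≤ ρ ∧ ‖(((U μ x)⁻¹ : 𝔸ˣ) : 𝔸)‖ ≤ ρ)
    (hd₀F : ∀ μ x, g.dist (blk x) (blk (T μ x)) ≤ d₀) (hd₀0 : ∀ y : g.Site, g.dist y y ≤ d₀) (k₀ : κ) :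
    HasMajorant (g := toB6 g Rr H) (fun q : (κ × S) × ι => blk q.1.2) (conj b (mixLetterB₂ T U A k₀))
      (fun y y' => (2 * (1 + 2 * ρ ^ 2) * M₂ * (∑ i, ‖b i‖) * Real.exp (δ * d₀)) * α₁ * (g.len y)⁻¹ *
        Real.exp (-(δ * g.dist y y'))) := by
  have hc0 : ∀ y : g.Site, 0 ≤ 2 * (1 + 2 * ρ ^ 2) * α₁ * (g.len y)⁻¹ := fun y => by have := hlen y; positivity
  refine hasMajorant_mono (g := toB6 g Rr H) _
    (hasMajorant_conj_of_local (Rr := Rr) (H := H) b (fun p : κ × S => blk p.2)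
      (fun p q => q.2 = p.2 ∨ ∃ μ, q.2 = T μ p.2)
      (fun y => 2 * (1 + 2 * ρ ^ 2) * α₁ * (g.len y)⁻¹) d₀ δ M₂ hc0 hδ hM₂ hrepr ?_ (mixLetterB₂ T U A k₀) ?_)
    fun y y' => le_of_eq (by ring)
  · rintro p q (h | ⟨μ, h⟩)
    · rw [h]; exact hd₀0 _
    · rw [h]; exact hd₀F μ p.2
  · intro G p B hB
    have hτG : ‖tauF T U p.1 (fun z => G (k₀, z)) p.2‖ ≤ ρ ^ 2 * B := by
      rw [tauF_apply]
      refine (norm_R_le_sq _ (hρ p.1 _).1 (hρ p.1 _).2 _).trans ?_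
      exact mul_le_mul_of_nonneg_left (hB (k₀, T p.1 p.2) (Or.inr ⟨p.1, rfl⟩)) (sq_nonneg _)
    have h1 : ‖(I : ℂ) • ad (A p.1 p.2) (tauF T U p.1 (fun z => G (k₀, z)) p.2)‖ ≤ 2 * (α₁ * (g.len (blk p.2))⁻¹) * (ρ ^ 2 * B) :=
      norm_I_ad_le (hA p.1 p.2) hτG
    have h2 : ‖(I : ℂ) • ad (tauF T U p.1 (A k₀) p.2) (tauF T U p.1 (fun z => G (k₀, z)) p.2)‖
        ≤ 2 * (α₁ * (g.len (blk p.2))⁻¹) * (ρ ^ 2 * B) := norm_I_ad_le (hAτ p.1 k₀ p.2) hτG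
    have h3 : ‖(I : ℂ) • ad (A k₀ p.2) (G (k₀, p.2))‖ ≤ 2 * (α₁ * (g.len (blk p.2))⁻¹) * B :=
      norm_I_ad_le (hA k₀ p.2) (hB (k₀, p.2) (Or.inl rfl))
    rw [mixLetterB₂_apply]
    calc _ ≤ ‖(I : ℂ) • ad (A p.1 p.2) (tauF T U p.1 (fun z => G (k₀, z)) p.2)
              - (I : ℂ) • ad (tauF T U p.1 (A k₀) p.2) (tauF T U p.1 (fun z => G (k₀, z)) p.2)‖
            + ‖(I : ℂ) • ad (A k₀ p.2) (G (k₀, p.2))‖ := norm_add_le _ _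
      _ ≤ (‖(I : ℂ) • ad (A p.1 p.2) (tauF T U p.1 (fun z => G (k₀, z)) p.2)‖
              + ‖(I : ℂ) • ad (tauF T U p.1 (A k₀) p.2) (tauF T U p.1 (fun z => G (k₀, z)) p.2)‖)
            + ‖(I : ℂ) • ad (A k₀ p.2) (G (k₀, p.2))‖ := add_le_add (norm_sub_le _ _) le_rfl
      _ ≤ (2 * (α₁ * (g.len (blk p.2))⁻¹) * (ρ ^ 2 * B) + 2 * (α₁ * (g.len (blk p.2))⁻¹) * (ρ ^ 2 * B))
            + 2 * (α₁ * (g.len (blk p.2))⁻¹) * B := add_le_add (add_le_add h1 h2) h3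
      _ = 2 * (1 + 2 * ρ ^ 2) * α₁ * (g.len (blk p.2))⁻¹ * B := by ring

omit [Fintype ι] b T U [Fintype g.Site] [NormedAlgebra ℂ 𝔸] in
/-- The transport bound `‖R(V)⁻¹Z‖ ≦ ρ²‖Z‖` for `‖V‖, ‖V⁻¹‖ ≦ ρ`. [folklore] -/
private theorem norm_Rinv_le_sq (V : 𝔸ˣ) {ρ : ℝ} (h1 : ‖(V : 𝔸)‖ ≤ ρ) (h2 : ‖((V⁻¹ : 𝔸ˣ) : 𝔸)‖ ≤ ρ) (Z : 𝔸) :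
    ‖R V⁻¹ Z‖ ≤ ρ ^ 2 * ‖Z‖ :=
  norm_R_le_sq V⁻¹ h2 (by simpa using h1) Z

variable [Fintype κ]

/-- **`hV0` FOR THE ZEROTH-ORDER LETTER OF THE BRACKET OF (3.75)** (terms 5, 6, 7): under (3.37) read blockwise on the stencil of the
output bond for the DIFFERENCES of the exponent field as they occur (`‖c·(D¹_μA_ν)(x)‖`, `‖c·(D¹*_νA_ν)(x)‖`, `‖c·(D¹*_νA_ν)(x+e_μ)‖ ≦
α₁(Lʲη)⁻²`, `c = η⁻¹`, for all μ, ν, `x ∈ Δ(y)`), transports `≦ ρ` and the stencil geometry (forward, backward and forward-backward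
neighbours at block distance `≦ d₀`): `conj b (zeroLetter₂ c A) ≺ 2(2ρ²+ρ⁶)d·M₂(Σ‖b_i‖)e^{δd₀}·α₁(Lʲη)⁻²·e^{−δd}` (`d = card κ`) — the letter
size `|V⁰| ≦ O(1)α₁(Lʲη)⁻²` of the gradient-form reading of (3.73), bracket part of `V₂`.
[cite: Balaban1985BackgroundPropagators, (3.37) p.396 + (3.75) p.405 + (3.73) p.405; Balaban1984PropagatorsII, (2.51)–(2.52) p.232] -/
theorem hasMajorant_zeroLetter₂ (blk : S → g.Site) (c : ℂ) (A : κ → S → 𝔸) (ρ d₀ δ M₂ α₁ : ℝ)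
    (hα₁ : 0 ≤ α₁) (hδ : 0 ≤ δ) (hM₂ : 0 ≤ M₂) (hrepr : ∀ (v : 𝔸) (i : ι), |b.repr v i| ≤ M₂ * ‖v‖)
    (h337F : ∀ μ ν x, ‖c • covD T U μ (A ν) x‖ ≤ α₁ * (g.len (blk x) ^ 2)⁻¹)
    (h337B : ∀ ν x, ‖c • covDstar T U ν (A ν) x‖ ≤ α₁ * (g.len (blk x) ^ 2)⁻¹)
    (h337B' : ∀ μ ν x, ‖c • covDstar T U ν (A ν) (T μ x)‖ ≤ α₁ * (g.len (blk x) ^ 2)⁻¹)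
    (hρ : ∀ μ x, ‖((U μ x : 𝔸ˣ) : 𝔸)‖ ≤ ρ ∧ ‖(((U μ x)⁻¹ : 𝔸ˣ) : 𝔸)‖ ≤ ρ)
    (hd₀F : ∀ μ x, g.dist (blk x) (blk (T μ x)) ≤ d₀) (hd₀B : ∀ ν x, g.dist (blk x) (blk ((T ν).symm x)) ≤ d₀)
    (hd₀FB : ∀ μ ν x, g.dist (blk x) (blk ((T ν).symm (T μ x))) ≤ d₀) :
    HasMajorant (g := toB6 g Rr H) (fun q : (κ × S) × ι => blk q.1.2) (conj b (zeroLetter₂ T U c A))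
      (fun y y' => (2 * (2 * ρ ^ 2 + ρ ^ 6) * Fintype.card κ * M₂ * (∑ i, ‖b i‖) * Real.exp (δ * d₀)) * α₁ *
        (g.len y ^ 2)⁻¹ * Real.exp (-(δ * g.dist y y'))) := by
  have hc0 : ∀ y : g.Site, 0 ≤ 2 * (2 * ρ ^ 2 + ρ ^ 6) * Fintype.card κ * α₁ * (g.len y ^ 2)⁻¹ := fun y => by positivity
  refine hasMajorant_mono (g := toB6 g Rr H) _
    (hasMajorant_conj_of_local (Rr := Rr) (H := H) b (fun p : κ × S => blk p.2)
      (fun p q => (∃ μ, q.2 = T μ p.2) ∨ (∃ μ ν, q.2 = (T ν).symm (T μ p.2)) ∨ ∃ ν, q.2 = (T ν).symm p.2)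
      (fun y => 2 * (2 * ρ ^ 2 + ρ ^ 6) * Fintype.card κ * α₁ * (g.len y ^ 2)⁻¹) d₀ δ M₂ hc0 hδ hM₂ hrepr ?_
      (zeroLetter₂ T U c A) ?_)
    fun y y' => le_of_eq (by ring)
  · rintro p q (⟨μ, h⟩ | ⟨μ, ν, h⟩ | ⟨ν, h⟩)
    · rw [h]; exact hd₀F μ p.2
    · rw [h]; exact hd₀FB μ ν p.2
    · rw [h]; exact hd₀B ν p.2
  · intro F p B hB
    rw [zeroLetter₂_apply]
    have hterm : ∀ ν, ‖(I : ℂ) • ad (c • covD T U p.1 (A ν) p.2) (tauF T U p.1 (fun z => F (ν, z)) p.2)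
        + (I : ℂ) • ad (c • tauF T U p.1 (covDstar T U ν (A ν)) p.2) (tauF T U p.1 (tauB T U ν (fun w => F (ν, w))) p.2)
        - (I : ℂ) • ad (c • covDstar T U ν (A ν) p.2) (tauB T U ν (fun w => F (ν, w)) p.2)‖
        ≤ 2 * (2 * ρ ^ 2 + ρ ^ 6) * (α₁ * (g.len (blk p.2) ^ 2)⁻¹) * B := by
      intro ν
      have hτF : ‖tauF T U p.1 (fun z => F (ν, z)) p.2‖ ≤ ρ ^ 2 * B := by
        rw [tauF_apply]
        refine (norm_R_le_sq _ (hρ p.1 _).1 (hρ p.1 _).2 _).trans ?_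
        exact mul_le_mul_of_nonneg_left (hB (ν, T p.1 p.2) (Or.inl ⟨p.1, rfl⟩)) (sq_nonneg _)
      have hτB : ‖tauB T U ν (fun w => F (ν, w)) p.2‖ ≤ ρ ^ 2 * B := by
        rw [tauB_apply]
        refine (norm_Rinv_le_sq _ (hρ ν _).1 (hρ ν _).2 _).trans ?_
        exact mul_le_mul_of_nonneg_left (hB (ν, (T ν).symm p.2) (Or.inr (Or.inr ⟨ν, rfl⟩))) (sq_nonneg _)
      have hτFB : ‖tauF T U p.1 (tauB T U ν (fun w => F (ν, w))) p.2‖ ≤ ρ ^ 2 * (ρ ^ 2 * B) := by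
        rw [tauF_apply]
        refine (norm_R_le_sq _ (hρ p.1 _).1 (hρ p.1 _).2 _).trans (mul_le_mul_of_nonneg_left ?_ (sq_nonneg _))
        rw [tauB_apply]
        refine (norm_Rinv_le_sq _ (hρ ν _).1 (hρ ν _).2 _).trans ?_
        exact mul_le_mul_of_nonneg_left (hB (ν, (T ν).symm (T p.1 p.2)) (Or.inr (Or.inl ⟨p.1, ν, rfl⟩))) (sq_nonneg _)
      have hcoef : ‖c • tauF T U p.1 (covDstar T U ν (A ν)) p.2‖ ≤ ρ ^ 2 * (α₁ * (g.len (blk p.2) ^ 2)⁻¹) := by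
        rw [tauF_apply, ← R_smul]
        exact (norm_R_le_sq _ (hρ p.1 _).1 (hρ p.1 _).2 _).trans
          (mul_le_mul_of_nonneg_left (h337B' p.1 ν p.2) (sq_nonneg _))
      have h5 : ‖(I : ℂ) • ad (c • covD T U p.1 (A ν) p.2) (tauF T U p.1 (fun z => F (ν, z)) p.2)‖
          ≤ 2 * (α₁ * (g.len (blk p.2) ^ 2)⁻¹) * (ρ ^ 2 * B) := norm_I_ad_le (h337F p.1 ν p.2) hτF
      have h6 : ‖(I : ℂ) • ad (c • tauF T U p.1 (covDstar T U ν (A ν)) p.2)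
            (tauF T U p.1 (tauB T U ν (fun w => F (ν, w))) p.2)‖
          ≤ 2 * (ρ ^ 2 * (α₁ * (g.len (blk p.2) ^ 2)⁻¹)) * (ρ ^ 2 * (ρ ^ 2 * B)) := norm_I_ad_le hcoef hτFB
      have h7 : ‖(I : ℂ) • ad (c • covDstar T U ν (A ν) p.2) (tauB T U ν (fun w => F (ν, w)) p.2)‖
          ≤ 2 * (α₁ * (g.len (blk p.2) ^ 2)⁻¹) * (ρ ^ 2 * B) := norm_I_ad_le (h337B ν p.2) hτB
      calc _ ≤ ‖(I : ℂ) • ad (c • covD T U p.1 (A ν) p.2) (tauF T U p.1 (fun z => F (ν, z)) p.2)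
              + (I : ℂ) • ad (c • tauF T U p.1 (covDstar T U ν (A ν)) p.2)
                  (tauF T U p.1 (tauB T U ν (fun w => F (ν, w))) p.2)‖
            + ‖(I : ℂ) • ad (c • covDstar T U ν (A ν) p.2) (tauB T U ν (fun w => F (ν, w)) p.2)‖ := norm_sub_le _ _
        _ ≤ (‖(I : ℂ) • ad (c • covD T U p.1 (A ν) p.2) (tauF T U p.1 (fun z => F (ν, z)) p.2)‖
              + ‖(I : ℂ) • ad (c • tauF T U p.1 (covDstar T U ν (A ν)) p.2)
                  (tauF T U p.1 (tauB T U ν (fun w => F (ν, w))) p.2)‖)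
            + ‖(I : ℂ) • ad (c • covDstar T U ν (A ν) p.2) (tauB T U ν (fun w => F (ν, w)) p.2)‖ :=
          add_le_add (norm_add_le _ _) le_rfl
        _ ≤ (2 * (α₁ * (g.len (blk p.2) ^ 2)⁻¹) * (ρ ^ 2 * B)
              + 2 * (ρ ^ 2 * (α₁ * (g.len (blk p.2) ^ 2)⁻¹)) * (ρ ^ 2 * (ρ ^ 2 * B)))
            + 2 * (α₁ * (g.len (blk p.2) ^ 2)⁻¹) * (ρ ^ 2 * B) := add_le_add (add_le_add h5 h6) h7
        _ = 2 * (2 * ρ ^ 2 + ρ ^ 6) * (α₁ * (g.len (blk p.2) ^ 2)⁻¹) * B := by ring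
    refine (norm_sum_le _ _).trans ?_
    calc ∑ ν, ‖(I : ℂ) • ad (c • covD T U p.1 (A ν) p.2) (tauF T U p.1 (fun z => F (ν, z)) p.2)
            + (I : ℂ) • ad (c • tauF T U p.1 (covDstar T U ν (A ν)) p.2) (tauF T U p.1 (tauB T U ν (fun w => F (ν, w))) p.2)
            - (I : ℂ) • ad (c • covDstar T U ν (A ν) p.2) (tauB T U ν (fun w => F (ν, w)) p.2)‖
          ≤ ∑ _ν : κ, 2 * (2 * ρ ^ 2 + ρ ^ 6) * (α₁ * (g.len (blk p.2) ^ 2)⁻¹) * B :=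
          Finset.sum_le_sum fun ν _ => hterm ν
      _ = 2 * (2 * ρ ^ 2 + ρ ^ 6) * Fintype.card κ * α₁ * (g.len (blk p.2) ^ 2)⁻¹ * B := by
          rw [Finset.sum_const, Finset.card_univ, nsmul_eq_mul]; ring

variable [DecidableEq κ]

omit T U in
/-- **`hV1` FOR THE FORWARD COEFFICIENT LETTER** (term 4; block-diagonal stencil `{x}`): under `‖A_ν(x)‖ ≦ α₁(Lʲη)⁻¹` for `x ∈ Δ(y)`,
`conj b (mixLetterF₂ A k₀) ≺ 2d·M₂(Σ‖b_i‖)e^{δd₀}·α₁(Lʲη)⁻¹·e^{−δd}` (`d = card κ`).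
[cite: Balaban1985BackgroundPropagators, (3.37) p.396 + (3.75) p.405 + (3.73) p.405; Balaban1984PropagatorsII, (2.51) p.232] -/
theorem hasMajorant_mixLetterF₂ (blk : S → g.Site) (A : κ → S → 𝔸) (d₀ δ M₂ α₁ : ℝ)
    (hα₁ : 0 ≤ α₁) (hδ : 0 ≤ δ) (hM₂ : 0 ≤ M₂) (hrepr : ∀ (v : 𝔸) (i : ι), |b.repr v i| ≤ M₂ * ‖v‖)
    (hlen : ∀ y : g.Site, 0 < g.len y) (hA : ∀ k x, ‖A k x‖ ≤ α₁ * (g.len (blk x))⁻¹)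
    (hd₀0 : ∀ y : g.Site, g.dist y y ≤ d₀) (k₀ : κ) :
    HasMajorant (g := toB6 g Rr H) (fun q : (κ × S) × ι => blk q.1.2) (conj b (mixLetterF₂ A k₀))
      (fun y y' => (2 * Fintype.card κ * M₂ * (∑ i, ‖b i‖) * Real.exp (δ * d₀)) * α₁ * (g.len y)⁻¹ *
        Real.exp (-(δ * g.dist y y'))) := by
  have hc0 : ∀ y : g.Site, 0 ≤ 2 * Fintype.card κ * α₁ * (g.len y)⁻¹ := fun y => by have := hlen y; positivity
  refine hasMajorant_mono (g := toB6 g Rr H) _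
    (hasMajorant_conj_of_local (Rr := Rr) (H := H) b (fun p : κ × S => blk p.2) (fun p q => q.2 = p.2)
      (fun y => 2 * Fintype.card κ * α₁ * (g.len y)⁻¹) d₀ δ M₂ hc0 hδ hM₂ hrepr (fun p q h => by rw [h]; exact hd₀0 _)
      (mixLetterF₂ A k₀) ?_)
    fun y y' => le_of_eq (by ring)
  intro G p B hB
  have hB0 : 0 ≤ B := (norm_nonneg _).trans (hB p rfl)
  rw [mixLetterF₂_apply]
  have hsum : ‖∑ ν, (I : ℂ) • ad (A ν p.2) (G (ν, p.2))‖ ≤ Fintype.card κ * (2 * (α₁ * (g.len (blk p.2))⁻¹) * B) := by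
    refine (norm_sum_le _ _).trans ?_
    rw [← Finset.card_univ, ← nsmul_eq_mul, ← Finset.sum_const]
    exact Finset.sum_le_sum fun ν _ => norm_I_ad_le (hA ν p.2) (hB (ν, p.2) rfl)
  split_ifs with h
  · rw [one_smul]
    refine hsum.trans (le_of_eq ?_)
    ring
  · rw [zero_smul, norm_zero]
    exact mul_nonneg (hc0 _) hB0

/-- **`hV1` FOR EVERY COEFFICIENT LETTER `V¹_k` OF THE BRACKET OF (3.75)** (`k ∈ κ ⊕ κ`): `conj b (V1Letter₂ A k) ≺ c_B·α₁(Lʲη)⁻¹e^{−δd}`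
with ONE constant `c_B = 2(1+2ρ²)(d+1)·M₂(Σ‖b_i‖)e^{δd₀}` for both kinds of index — the letter size `|V¹| ≦ O(1)α₁(Lʲη)⁻¹` of the
gradient-form reading of (3.73) for the bracket part of `V₂(A)`, as a theorem about the concrete lattice operators.
[cite: Balaban1985BackgroundPropagators, (3.37) p.396 + (3.75) p.405 + (3.73) p.405; Balaban1984PropagatorsII, (2.51)–(2.52) p.232] -/
theorem hasMajorant_V1Letter₂ (blk : S → g.Site) (A : κ → S → 𝔸) (ρ d₀ δ M₂ α₁ : ℝ)
    (hα₁ : 0 ≤ α₁) (hδ : 0 ≤ δ) (hM₂ : 0 ≤ M₂) (hrepr : ∀ (v : 𝔸) (i : ι), |b.repr v i| ≤ M₂ * ‖v‖)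
    (hlen : ∀ y : g.Site, 0 < g.len y)
    (hA : ∀ k x, ‖A k x‖ ≤ α₁ * (g.len (blk x))⁻¹) (hAτ : ∀ μ k x, ‖tauF T U μ (A k) x‖ ≤ α₁ * (g.len (blk x))⁻¹)
    (hρ : ∀ μ x, ‖((U μ x : 𝔸ˣ) : 𝔸)‖ ≤ ρ ∧ ‖(((U μ x)⁻¹ : 𝔸ˣ) : 𝔸)‖ ≤ ρ)
    (hd₀F : ∀ μ x, g.dist (blk x) (blk (T μ x)) ≤ d₀) (hd₀0 : ∀ y : g.Site, g.dist y y ≤ d₀) (k : κ ⊕ κ) :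
    HasMajorant (g := toB6 g Rr H) (fun q : (κ × S) × ι => blk q.1.2) (conj b (V1Letter₂ T U A k))
      (fun y y' => (2 * (1 + 2 * ρ ^ 2) * (Fintype.card κ + 1) * M₂ * (∑ i, ‖b i‖) * Real.exp (δ * d₀)) * α₁ *
        (g.len y)⁻¹ * Real.exp (-(δ * g.dist y y'))) := by
  have hw : ∀ y y' : g.Site, 0 ≤ M₂ * (∑ i, ‖b i‖) * Real.exp (δ * d₀) * α₁ * (g.len y)⁻¹ *
      Real.exp (-(δ * g.dist y y')) := fun y y' => by
    have := hlen y; positivity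
  have hκ : (0 : ℝ) ≤ Fintype.card κ := Nat.cast_nonneg _
  rcases k with k₀ | k₀
  · rw [V1Letter₂_inl]
    refine hasMajorant_mono (g := toB6 g Rr H) _
      (hasMajorant_mixLetterF₂ (Rr := Rr) (H := H) b blk A d₀ δ M₂ α₁ hα₁ hδ hM₂ hrepr hlen hA hd₀0 k₀) fun y y' => ?_
    nlinarith [hw y y', mul_nonneg hκ (hw y y'), mul_nonneg (sq_nonneg ρ) (hw y y'),
      mul_nonneg (mul_nonneg (sq_nonneg ρ) hκ) (hw y y')]
  · rw [V1Letter₂_inr]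
    refine hasMajorant_mono (g := toB6 g Rr H) _
      (hasMajorant_mixLetterB₂ (Rr := Rr) (H := H) b T U blk A ρ d₀ δ M₂ α₁ hα₁ hδ hM₂ hrepr hlen hA hAτ hρ hd₀F hd₀0 k₀)
      fun y y' => ?_
    nlinarith [hw y y', mul_nonneg hκ (hw y y'), mul_nonneg (sq_nonneg ρ) (hw y y'),
      mul_nonneg (mul_nonneg (sq_nonneg ρ) hκ) (hw y y')]

/-- **THE CONJUGATED GRADIENT FORM** (the `hV₃`-shape identity of the finite-sum device for the bracket part of `V₂(A)`):
`conj b (V₂brkOp c A) = conj b V⁰ + Σ_{k∈κ⊕κ} conj b (V¹_k) ∘ conj b (∇_k)`.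
[cite: Balaban1985BackgroundPropagators, (3.75) p.405 + (3.73) p.405; Balaban1984PropagatorsII, (2.52)–(2.55) p.232] -/
theorem conj_V₂brkOp_eq_gradForm (c : ℂ) (A : κ → S → 𝔸) :
    conj b (V₂brkOp T U c A) = conj b (zeroLetter₂ T U c A)
      + ∑ k ∈ Finset.univ, conj b (V1Letter₂ T U A k) * conj b (diffLetter (bT T) (bU U) c k) := by
  rw [V₂brkOp_eq_gradForm, conj_add, conj_finset_sum]
  simp only [B9Eq352DivFormLetters.conj_mul]

end Majorants0

end Literature.MathematicalPhysics.QuantumFieldTheory.Balaban1983to89.B9Eq375GradLetters
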